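import Literature.MathematicalPhysics.QuantumFieldTheory.Balaban1983to89.TorusHypercubicSymmetry
import Literature.MathematicalPhysics.QuantumFieldTheory.Balaban1983to89.B10StarCount

/-!
# BalabanUVNodes ∕ N07 ([Balaban1985Variational] (5) p. 278; LOCATED-M5 certificate, part 22a) — THE UNIFORM-FLUX CONFIGURATION ON THE
# TORUS: bond variables `U b = D ^ e b` (commuting powers of ONE group element), the CURL of the flux exponents, and the plaquette
# holonomies `U(∂p) = D` on one coordinate plane, `= 1` elsewhere (given `D ^ (n²) = 1`, `n` = sites per direction)

Cell `pub-ymgap`, seat `pub-ymgap-dag-n07-e` generation 8 (R141 (C), DAG node N07 = [15]; ROW P11 negative lane, INBOX INTENT-22).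
`--kind proof --supports stmt-QuantumFields-20293 --as helper`.  THEOREMS ONLY (0 `def`, 0 `sorry`): the configuration and its exponents enter as HYPOTHESES
(`hU : ∀ b, U b = D ^ e b`, `he : ∀ b, e b = …`); instances are exhibited by `∃` in part 22c.

WHAT THIS FILE DOES (elementary lattice bookkeeping on the torus `T^{(j)}` of `…Setup`, any `GaugeGroup G`).  Fix two directions `μ₀ < ν₀` and write `n = sitesPerDir j`,
`x₁ = val x_{μ₀}`, `x₂ = val x_{ν₀}`.  The FLUX EXPONENTS are `e⟨x, ν₀⟩ = x₁`, `e⟨x, μ₀⟩ = −n·x₂` on the last `μ₀`-layer `x₁ = n − 1` and `0` otherwise, `e⟨x, μ⟩ = 0`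
for `μ ∉ {μ₀, ν₀}` (§2).  For ANY configuration of commuting powers `U b = D ^ e b` the plaquette holonomy is `D ^ curl e (p)` (§1, `plaqHol_eq_zpow`); the curl of
the flux exponents is `1` on every `(μ₀, ν₀)`-plaquette except the doubly-wrapping corner one where it is `1 − n²`, and `0` on every other plaquette (§2,
`curl_fluxExp`); hence, when `D ^ (n²) = 1`, ★ `plaqHol_flux_eq : U(∂p) = D` on the `(μ₀, ν₀)`-plane and `= 1` off it (§3) — a configuration with CONSTANT
non-trivial field strength on one plane (uniform abelian flux through the `(μ₀, ν₀)`-torus, flux quantum `n²`).  Part 22b shows it is a critical configuration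
of the Wilson action (5); part 22c turns it into the kernel certificate of this seat's LOCATED-M5 (`¬ Node00.Prop8RegSepPrinted` at `k = 0`).

HONEST FRAMING: count-neutral lattice bookkeeping; nothing of Bałaban asserted; N07 ∕ K0 NOT discharged (5∕27); one finite torus — NOT continuum ∕ ℝ⁴ ∕ OS ∕ mass gap ∕ Clay.

DEPENDENCES (by name): `…Setup` (`Site`, `PBond`, `Plaq`, `GaugeField.plaqHol`, `Params.sitesPerDir`), `Site.shift_apply` (TorusHypercubicSymmetry),
`B10StarCount.(shift_apply_self, shift_apply_ne)`; `2 ≤ sitesPerDir` is `BIJ85Ineq732FlatRegion.two_le_sitesPerDir` (inlined here to keep the import light).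
-/

namespace Summit.QuantumFields.YangMills.BalabanUVNodes.N07UniformFlux

open Literature.MathematicalPhysics.QuantumFieldTheory.Balaban1983to89

variable {P : Params} {j : ℕ}

/-! ## §0  Labels on the torus: `val (x_μ + 1)` -/

/-- The label of `x_μ + 1`: `x₁ + 1`, wrapping to `0` on the last layer `x₁ = n − 1` (every direction has `2·L^{m+K−j} ≥ 2` sites, cf.
`BIJ85Ineq732FlatRegion.two_le_sitesPerDir`). [cite: Balaban1987RG1, (0.1) p.251 (bookkeeping)] -/
theorem val_add_one (x : ZMod (P.sitesPerDir j)) : (x + 1).val = if x.val = P.sitesPerDir j - 1 then 0 else x.val + 1 := by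
  have h2 : 2 ≤ P.sitesPerDir j := by
    unfold Params.sitesPerDir
    have h := Nat.one_le_pow (P.m + P.K - j) P.L P.L_pos
    omega
  have h1 : (1 : ZMod (P.sitesPerDir j)).val = 1 := by
    rw [ZMod.val_one_eq_one_mod]; exact Nat.mod_eq_of_lt (by omega)
  have hx := ZMod.val_lt x
  split_ifs with h
  · rw [ZMod.val_add, h1, h]
    have h3 : P.sitesPerDir j - 1 + 1 = P.sitesPerDir j := by omega
    rw [h3, Nat.mod_self]
  · rw [ZMod.val_add_of_lt (by rw [h1]; omega), h1]

/-- `val (x + e_μ)_μ`. [cite: Balaban1987RG1, (0.1) p.251 (bookkeeping)] -/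
theorem val_shift_self (x : Site P j) (μ : Fin P.d) :
    ((x.shift μ) μ).val = if (x μ).val = P.sitesPerDir j - 1 then 0 else (x μ).val + 1 := by
  rw [B10StarCount.shift_apply_self]; exact val_add_one (x μ)

/-- `val (x + e_μ)_ν = val x_ν` for `ν ≠ μ`. [cite: Balaban1987RG1, (0.1) p.251 (bookkeeping)] -/
theorem val_shift_ne (x : Site P j) {μ ν : Fin P.d} (h : ν ≠ μ) : ((x.shift μ) ν).val = (x ν).val := by
  rw [B10StarCount.shift_apply_ne x h]

/-! ## §1  Configurations of commuting powers: `U(∂p) = D ^ curl e (p)` -/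

section Powers

variable {G : Type*} [GaugeGroup G]

/-- **HOLONOMY OF A CONFIGURATION OF COMMUTING POWERS**: if every bond variable is a power of one element, `U b = D ^ e b`, then
`U(∂p) = D ^ (e_a + e_b − e_c − e_d)` (the lattice CURL of the exponents around `p`; `a, b, c, d` the four bonds of `p` in `…Setup`'s order).
[cite: Balaban1985Averaging, (9) p.19 (bookkeeping)] -/
theorem plaqHol_eq_zpow (D : G) (e : PBond P j → ℤ) {U : GaugeField P j G} (hU : ∀ b, U b = D ^ e b) (p : Plaq P j) :
    GaugeField.plaqHol U p = D ^ (e ⟨p.src, p.μ⟩ + e ⟨p.src.shift p.μ, p.ν⟩ - e ⟨p.src.shift p.ν, p.μ⟩ - e ⟨p.src, p.ν⟩) := by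
  unfold GaugeField.plaqHol
  rw [hU, hU, hU, hU, ← zpow_neg, ← zpow_neg, ← zpow_add, ← zpow_add, ← zpow_add]
  congr 1

/-- Bond variables which are powers of one element commute with it. [folklore] -/
theorem commute_of_eq_zpow (D : G) (e : PBond P j → ℤ) {U : GaugeField P j G} (hU : ∀ b, U b = D ^ e b) (b : PBond P j) :
    Commute (U b) D := by
  rw [hU]; exact Commute.zpow_left (Commute.refl D) (e b)

/-- Powers of an element of finite exponent `m` depend on the exponent modulo `m`. [folklore] -/
theorem zpow_eq_zpow_of_pow_eq_one {D : G} {m : ℕ} (hD : D ^ m = 1) {a b : ℤ} (h : (m : ℤ) ∣ a - b) : D ^ a = D ^ b := by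
  obtain ⟨k, hk⟩ := h
  have hab : a = b + m * k := by linarith
  rw [hab, zpow_add, zpow_mul, zpow_natCast, hD, one_zpow, mul_one]

end Powers

/-! ## §2  The flux exponents and their curl -/

section Flux

variable (μ0 ν0 : Fin P.d)

/-- The flux exponent of a `ν₀`-bond: `x₁`. [cite: Balaban1985Variational, (5) p.278 (bookkeeping)] -/
theorem fluxExp_nu {e : PBond P j → ℤ}
    (he : ∀ b : PBond P j, e b = if b.dir = ν0 then ((b.src μ0).val : ℤ)
      else if b.dir = μ0 ∧ (b.src μ0).val = P.sitesPerDir j - 1 then -((P.sitesPerDir j : ℤ) * (b.src ν0).val) else 0)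
    (y : Site P j) : e ⟨y, ν0⟩ = ((y μ0).val : ℤ) := by
  rw [he, if_pos rfl]

/-- The flux exponent of a `μ₀`-bond: `−n·x₂` on the last `μ₀`-layer, else `0`. [cite: Balaban1985Variational, (5) p.278 (bookkeeping)] -/
theorem fluxExp_mu (hne : μ0 ≠ ν0) {e : PBond P j → ℤ}
    (he : ∀ b : PBond P j, e b = if b.dir = ν0 then ((b.src μ0).val : ℤ)
      else if b.dir = μ0 ∧ (b.src μ0).val = P.sitesPerDir j - 1 then -((P.sitesPerDir j : ℤ) * (b.src ν0).val) else 0)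
    (y : Site P j) :
    e ⟨y, μ0⟩ = if (y μ0).val = P.sitesPerDir j - 1 then -((P.sitesPerDir j : ℤ) * (y ν0).val) else 0 := by
  rw [he, if_neg hne]
  simp only [true_and]

/-- The flux exponent of a bond in any other direction: `0`. [cite: Balaban1985Variational, (5) p.278 (bookkeeping)] -/
theorem fluxExp_other {e : PBond P j → ℤ}
    (he : ∀ b : PBond P j, e b = if b.dir = ν0 then ((b.src μ0).val : ℤ)
      else if b.dir = μ0 ∧ (b.src μ0).val = P.sitesPerDir j - 1 then -((P.sitesPerDir j : ℤ) * (b.src ν0).val) else 0)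
    {μ : Fin P.d} (h1 : μ ≠ μ0) (h2 : μ ≠ ν0) (y : Site P j) : e ⟨y, μ⟩ = 0 := by
  rw [he, if_neg h2, if_neg (fun h => h1 h.1)]

/-- ★ **THE CURL OF THE FLUX EXPONENTS**: around a `(μ₀, ν₀)`-plaquette it is `1`, except at the doubly-wrapping corner `x₁ = x₂ = n − 1` where it is `1 − n²`;
around every other plaquette it is `0`. [cite: Balaban1985Variational, (5) p.278 (bookkeeping)] -/
theorem curl_fluxExp (hμν : μ0 < ν0) {e : PBond P j → ℤ}
    (he : ∀ b : PBond P j, e b = if b.dir = ν0 then ((b.src μ0).val : ℤ)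
      else if b.dir = μ0 ∧ (b.src μ0).val = P.sitesPerDir j - 1 then -((P.sitesPerDir j : ℤ) * (b.src ν0).val) else 0)
    (p : Plaq P j) :
    e ⟨p.src, p.μ⟩ + e ⟨p.src.shift p.μ, p.ν⟩ - e ⟨p.src.shift p.ν, p.μ⟩ - e ⟨p.src, p.ν⟩ =
      if p.μ = μ0 ∧ p.ν = ν0 then
        (if (p.src μ0).val = P.sitesPerDir j - 1 ∧ (p.src ν0).val = P.sitesPerDir j - 1 then 1 - (P.sitesPerDir j : ℤ) ^ 2 else 1)
      else 0 := by
  have hne : μ0 ≠ ν0 := ne_of_lt hμν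
  have h1n : 1 ≤ P.sitesPerDir j := Nat.one_le_iff_ne_zero.mpr (P.sitesPerDir_ne_zero j)
  obtain ⟨x, μ, ν, hlt⟩ := p
  dsimp only
  by_cases hμ : μ = μ0
  · subst hμ
    by_cases hν : ν = ν0
    · subst hν
      rw [if_pos ⟨rfl, rfl⟩, fluxExp_mu μ ν hne he, fluxExp_nu μ ν he, fluxExp_mu μ ν hne he, fluxExp_nu μ ν he,
        val_shift_self, val_shift_ne x hne, val_shift_self]
      by_cases hx1 : (x μ).val = P.sitesPerDir j - 1
      · have hc1 : ((x μ).val : ℤ) = (P.sitesPerDir j : ℤ) - 1 := by omega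
        by_cases hx2 : (x ν).val = P.sitesPerDir j - 1
        · rw [if_pos hx1, if_pos hx1, if_pos hx1, if_pos hx2, if_pos ⟨hx1, hx2⟩, hc1]
          have hc2 : ((x ν).val : ℤ) = (P.sitesPerDir j : ℤ) - 1 := by omega
          rw [hc2]; push_cast; ring
        · rw [if_pos hx1, if_pos hx1, if_pos hx1, if_neg hx2, if_neg (fun h => hx2 h.2), hc1]
          push_cast; ring
      · rw [if_neg hx1, if_neg hx1, if_neg hx1, if_neg (fun h => hx1 h.1)]
        push_cast; ring
    · have hν' : ν ≠ μ := fun h => (lt_irrefl μ) (h ▸ hlt)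
      rw [if_neg (fun h => hν h.2), fluxExp_mu μ ν0 hne he, fluxExp_other μ ν0 he hν' hν, fluxExp_mu μ ν0 hne he,
        fluxExp_other μ ν0 he hν' hν, val_shift_ne x hν'.symm, val_shift_ne x (Ne.symm hν)]
      ring
  · rw [if_neg (fun h => hμ h.1)]
    by_cases hμ' : μ = ν0
    · subst hμ'
      have hν1 : ν ≠ μ0 := fun h => (lt_asymm hμν) (h ▸ hlt)
      have hν2 : ν ≠ μ := fun h => (lt_irrefl μ) (h ▸ hlt)
      rw [fluxExp_nu μ0 μ he, fluxExp_other μ0 μ he hν1 hν2, fluxExp_nu μ0 μ he, fluxExp_other μ0 μ he hν1 hν2,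
        val_shift_ne x (Ne.symm hν1)]
      ring
    · by_cases hν : ν = μ0
      · subst hν
        rw [fluxExp_other ν ν0 he hμ hμ', fluxExp_mu ν ν0 hne he, fluxExp_other ν ν0 he hμ hμ', fluxExp_mu ν ν0 hne he,
          val_shift_ne x (Ne.symm hμ), val_shift_ne x (Ne.symm hμ')]
        ring
      · by_cases hν' : ν = ν0
        · subst hν'
          rw [fluxExp_other μ0 ν he hμ hμ', fluxExp_nu μ0 ν he, fluxExp_other μ0 ν he hμ hμ', fluxExp_nu μ0 ν he,
            val_shift_ne x (Ne.symm hμ)]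
          ring
        · rw [fluxExp_other μ0 ν0 he hμ hμ', fluxExp_other μ0 ν0 he hν hν', fluxExp_other μ0 ν0 he hμ hμ',
            fluxExp_other μ0 ν0 he hν hν']
          ring

end Flux

/-! ## §3  The plaquette holonomies of the uniform-flux configuration -/

section Holonomy

variable {G : Type*} [GaugeGroup G] (μ0 ν0 : Fin P.d)

/-- ★ **UNIFORM FLUX**: for `D ^ (n²) = 1` and bond variables `U b = D ^ e b` with the flux exponents, EVERY `(μ₀, ν₀)`-plaquette has holonomy `D` and every
other plaquette is flat. [cite: Balaban1985Variational, (5) p.278 (bookkeeping)] -/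
theorem plaqHol_flux_eq (hμν : μ0 < ν0) {D : G} (hD : D ^ (P.sitesPerDir j ^ 2) = 1) {e : PBond P j → ℤ}
    (he : ∀ b : PBond P j, e b = if b.dir = ν0 then ((b.src μ0).val : ℤ)
      else if b.dir = μ0 ∧ (b.src μ0).val = P.sitesPerDir j - 1 then -((P.sitesPerDir j : ℤ) * (b.src ν0).val) else 0)
    {U : GaugeField P j G} (hU : ∀ b, U b = D ^ e b) (p : Plaq P j) :
    GaugeField.plaqHol U p = if p.μ = μ0 ∧ p.ν = ν0 then D else 1 := by
  rw [plaqHol_eq_zpow D e hU p, curl_fluxExp μ0 ν0 hμν he p]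
  split_ifs with hp hc
  · rw [zpow_eq_zpow_of_pow_eq_one hD (b := 1) ⟨-1, by push_cast; ring⟩, zpow_one]
  · exact zpow_one D
  · exact zpow_zero D

/-- In particular every plaquette holonomy of the uniform-flux configuration is `D` or `1`. [cite: Balaban1985Variational, (5) p.278 (bookkeeping)] -/
theorem plaqHol_flux_eq_or (hμν : μ0 < ν0) {D : G} (hD : D ^ (P.sitesPerDir j ^ 2) = 1) {e : PBond P j → ℤ}
    (he : ∀ b : PBond P j, e b = if b.dir = ν0 then ((b.src μ0).val : ℤ)
      else if b.dir = μ0 ∧ (b.src μ0).val = P.sitesPerDir j - 1 then -((P.sitesPerDir j : ℤ) * (b.src ν0).val) else 0)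
    {U : GaugeField P j G} (hU : ∀ b, U b = D ^ e b) (p : Plaq P j) :
    GaugeField.plaqHol U p = D ∨ GaugeField.plaqHol U p = 1 := by
  rw [plaqHol_flux_eq μ0 ν0 hμν hD he hU p]
  split_ifs
  · exact Or.inl rfl
  · exact Or.inr rfl

/-- The holonomy of the `(μ₀, ν₀)`-plaquette at any site is `D`. [cite: Balaban1985Variational, (5) p.278 (bookkeeping)] -/
theorem plaqHol_flux_plane (hμν : μ0 < ν0) {D : G} (hD : D ^ (P.sitesPerDir j ^ 2) = 1) {e : PBond P j → ℤ}
    (he : ∀ b : PBond P j, e b = if b.dir = ν0 then ((b.src μ0).val : ℤ)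
      else if b.dir = μ0 ∧ (b.src μ0).val = P.sitesPerDir j - 1 then -((P.sitesPerDir j : ℤ) * (b.src ν0).val) else 0)
    {U : GaugeField P j G} (hU : ∀ b, U b = D ^ e b) (x : Site P j) :
    GaugeField.plaqHol U ⟨x, μ0, ν0, hμν⟩ = D := by
  rw [plaqHol_flux_eq μ0 ν0 hμν hD he hU, if_pos (by exact ⟨rfl, rfl⟩)]

end Holonomy

end Summit.QuantumFields.YangMills.BalabanUVNodes.N07UniformFlux
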